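import Summits.RiemannHypothesis.RiemannHypothesis.Theorems.PfPersistenceM2EffectiveThreshold
import Summits.RiemannHypothesis.RiemannHypothesis.Theorems.PfPersistenceFloorRateOdd
import HarnessLib

/-!
# Pf-persistence index route (M2): the effective ODD threshold and the saturation window (`K = 1`)

pub-rhpf cell (M2 seat, generation 9).  HONEST FRAMING: long-odds MECHANISM SEARCH; no RH claims.
Every result here is RH-free and kernel-checked; none asserts or refutes RH.  Labels: PROVED.
Notation as in `PfPersistenceM2TranslationDefect` / `…EffectiveThreshold` (`Q`, `k̂`, `P_k`, `m`,
`g_T = (k(·-T) + k(·+T))/2`, `F(ρ,T) = cosh²((ρ-½)T)`); `h_T = (k(·-T) - k(·+T))/2` is the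
ODD antisymmetric translate of `PfPersistenceFloorRateOdd` (reused by name:
`isWeilTest_antiTranslate`, `antiTranslate_odd`, `tsupport_antiTranslate_subset`,
`zeroForm_antiTranslate`); lone-quadruple world = every off-line zero lies in `{e, ē, 1-e, 1-ē}`
(`K = #𝒬 = 1`, `δ = Re e - ½ > 0`, `γ = Im e`).

PROVED here:
* (L) `re_weilQuadratic_ge_of_lone` — LONE LOWER BOUND `4 m(e) Re P_f(e) ≤ Re Q(f)` for every
  EVEN real Weil test `f` (a zero ON the line contributes `m |f̂(ρ)|² ≥ 0` to `Q = Z`).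
* (O1) `re_weilQuadratic_antiTranslate_eq` — PARALLELOGRAM LAW `Re Q(h_T) = Re Q(k) - Re Q(g_T)`.
* (O2) `re_weilQuadratic_antiTranslate_le_of_lone` —
  `Re Q(h_T) ≤ Re Q(k) - 4 m(e) Re (P_k(e)F(e,T))`: for the ODD translate the on-line zeros work
  AGAINST negativity, and (L) applied to the even test `g_T` is what absorbs them.
* (O3) `le_re_mul_coshSq`, `exists_tuned_pos` — phase lemma, positive tuning `z e^{2iγT} = +|z|`.
* (O4) `oddNegIndexAtLeast_one_of_lone`, `sInf_oddNegIndexAtLeast_one_le_of_lone` — THE EFFECTIVE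
  ODD BOUND, the same window as the even one:
  `a₁^{od} ≤ a + max(0, arsinh(1 + Re Q(k)/(2m(e)|k̂(e)|²))/(2δ)) + π/γ`.
* (O5) `lone_zero_invisible_of_not_oddNegIndexAtLeast` — the odd rigidity (invisibility) reading.
* (O6) `sInf_realNegIndexAtLeast_two_le_of_lone` — SATURATION WINDOW: the REAL negative index
  reaches its maximal value `2 = 2K` (`not_realNegIndexAtLeast_succ_of_two_mul_encard_le`) below
  the same explicit window (cf. `sInf_realNegIndexAtLeast_two_eq_max_of_encard_eq_one`, gen. 8).

HONEST GRADE: VARIANT (effective Landau–Littlewood / Littlewood localisation, Weil form, odd sector)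
[cite: MontgomeryVaughan2007, Thm. 15.3, 15.8; Bombieri2000Weil, §5].  The ε₁-floor input is
untouched; under RH every hypothesis here is vacuous.  mechanism/rigidity campaign; no RH claims.
-/

noncomputable section
set_option linter.dupNamespace false

open Complex Filter Set MeasureTheory
open scoped Real Topology ComplexConjugate BigOperators

namespace Summit.RiemannHypothesis.RiemannHypothesis.Theorems.PfPersistenceM2NegIndex

open Literature.NumberTheory.LFunctions
open Literature.NumberTheory.LFunctions.WeilConverse
open Literature.NumberTheory.LFunctions.ZetaZeros
open Summit.RiemannHypothesis.RiemannHypothesis.Theorems.RuelleBandExactFirstBand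
open Summit.RiemannHypothesis.RiemannHypothesis.Theorems.PfPersistenceFloorRateOdd
open Summit.RiemannHypothesis.RiemannHypothesis.Theorems.PfPersistenceParityIndex
  (OddNegIndexAtLeast realNegIndexAtLeast_add_of_even_odd)

/-- `𝔰⟪k, T⟫` — the symmetric translate `t ↦ (k(t-T) + k(t+T))/2` (even if `k` is). -/
local notation "𝔰⟪" k ", " T "⟫" => fun t : ℝ => (k (t - T) + k (t + T)) / 2
/-- `𝔥⟪k, T⟫` — the antisymmetric translate `t ↦ (k(t-T) - k(t+T))/2` (odd if `k` is even). -/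
local notation "𝔥⟪" k ", " T "⟫" => fun t : ℝ => (k (t - T) - k (t + T)) / 2
/-- `𝔉⟪ρ, T⟫` — the zero-side weight `(e^{(ρ-½)2T} + e^{(½-ρ)2T} + 2)/4 = cosh²((ρ-½)T)`. -/
local notation "𝔉⟪" ρ ", " T "⟫" =>
  (cexp ((ρ - 1 / 2) * ((2 * T : ℝ) : ℂ)) + cexp ((1 / 2 - ρ) * ((2 * T : ℝ) : ℂ)) + 2) / 4

/-- A zero ON the critical line contributes `m(ρ) |f̂(ρ)|² ≥ 0` to the zero-side form of any test. -/
theorem re_order_mul_pairCoeff_nonneg_of_re_eq_half (f : ℝ → ℂ) {ρ : ℂ}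
    (hρmem : ρ ∈ riemannZetaNontrivialZeros) (hρ : ρ.re = 1 / 2) :
    0 ≤ ((riemannZetaZeroOrder ρ : ℂ) * pairCoeff f ρ).re := by
  have h1 : 1 - conj ρ = ρ := Complex.ext (by simp [hρ]; norm_num) (by simp)
  have hP : pairCoeff f ρ = (Complex.normSq (weilMellin f ρ) : ℂ) := by
    rw [pairCoeff, h1, Complex.mul_conj]
  have hm : (0 : ℝ) ≤ riemannZetaZeroOrder ρ := by
    exact_mod_cast riemannZetaZeroOrder_nonneg (riemannZetaNontrivialZeros.ne_one hρmem)
  rw [hP, ← Complex.ofReal_intCast, ← Complex.ofReal_mul, Complex.ofReal_re]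
  exact mul_nonneg hm (Complex.normSq_nonneg _)

/-- For an even real test, `Re (m(ρ̄) P_f(ρ̄)) = Re (m(ρ) P_f(ρ))`. -/
theorem re_order_mul_pairCoeff_conj {f : ℝ → ℂ} (hev : ∀ t : ℝ, f (-t) = f t)
    (hre : ∀ t : ℝ, (f t).im = 0) (ρ : ℂ) :
    ((riemannZetaZeroOrder (conj ρ) : ℂ) * pairCoeff f (conj ρ)).re =
      ((riemannZetaZeroOrder ρ : ℂ) * pairCoeff f ρ).re := by
  rw [riemannZetaZeroOrder_conj_holds ρ, pairCoeff_conj_of_even_real hev hre,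
    show (riemannZetaZeroOrder ρ : ℂ) * conj (pairCoeff f ρ) =
      conj ((riemannZetaZeroOrder ρ : ℂ) * pairCoeff f ρ) by simp only [map_mul, map_intCast],
    Complex.conj_re]

/-- **(L) Lone lower bound.** In the lone-quadruple world, for every EVEN real Weil test `f`:
`4 m(e) Re P_f(e) ≤ Re Q(f)` — the energy is at least the lone quadruple's contribution, because
every other zero is on the line and contributes `m |f̂(ρ)|² ≥ 0` (Weil's explicit formula `Q = Z`). -/
theorem re_weilQuadratic_ge_of_lone {f : ℝ → ℂ} (hf : IsWeilTest f)
    (hev : ∀ t : ℝ, f (-t) = f t) (hre : ∀ t : ℝ, (f t).im = 0) {e : ℂ}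
    (he : e ∈ riemannZetaNontrivialZeros) (hδ : 1 / 2 < e.re)
    (hlone : ∀ ρ ∈ riemannZetaNontrivialZeros,
      ρ.re ≠ 1 / 2 → ρ = e ∨ ρ = conj e ∨ ρ = 1 - e ∨ ρ = 1 - conj e) :
    4 * (riemannZetaZeroOrder e * (pairCoeff f e).re) ≤ (weilQuadratic f).re := by
  set W : ℂ → ℝ := fun ρ ↦ ((riemannZetaZeroOrder ρ : ℂ) * pairCoeff f ρ).re with hW
  have hQ : zeroForm f = weilQuadratic f :=
    tendsto_nhds_unique (hasWeilZeroSide_zeroForm hf) (explicit_formula_holds (hf.weilConv hf.weilReflect))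
  have htot : (weilQuadratic f).re = ∑' ρ : riemannZetaNontrivialZeros, W ρ := by
    rw [← hQ, zeroForm, Complex.re_tsum (summable_pairCoeff hf)]
  have hsW : Summable fun ρ : riemannZetaNontrivialZeros ↦ W ρ := by
    simpa [hW] using Complex.reCLM.summable (summable_pairCoeff hf)
  have h0 : 0 < e.re := by linarith
  have h1 : e.re < 1 := riemannZetaNontrivialZeros.re_lt_one he
  have him : e.im ≠ 0 := riemannZetaNontrivialZeros.im_ne_zero he
  have hce : conj e ∈ riemannZetaNontrivialZeros := riemannZetaNontrivialZeros.conj_mem he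
  have h1e : 1 - e ∈ riemannZetaNontrivialZeros := by
    simpa using riemannZetaNontrivialZeros.one_sub_conj_mem hce
  have h1ce : 1 - conj e ∈ riemannZetaNontrivialZeros :=
    riemannZetaNontrivialZeros.one_sub_conj_mem he
  have hWe : W e = riemannZetaZeroOrder e * (pairCoeff f e).re := by
    simp only [hW]
    rw [← Complex.ofReal_intCast, Complex.re_ofReal_mul]
  have hWce : W (conj e) = W e := by
    simp only [hW]; exact re_order_mul_pairCoeff_conj hev hre e
  have hW1e : W (1 - e) = W e := by
    simp only [hW]; rw [riemannZetaZeroOrder_one_sub_holds h0 h1, pairCoeff_one_sub_of_even hev]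
  have hW1ce : W (1 - conj e) = W e := by
    rw [← hWce]; simp only [hW]
    rw [riemannZetaZeroOrder_one_sub_holds (by simpa using h0) (by simpa using h1),
      pairCoeff_one_sub_of_even hev]
  set S : Finset riemannZetaNontrivialZeros :=
    {⟨e, he⟩, ⟨conj e, hce⟩, ⟨1 - e, h1e⟩, ⟨1 - conj e, h1ce⟩} with hS
  have hmemS : ∀ ρ : riemannZetaNontrivialZeros, (ρ : ℂ).re ≠ 1 / 2 → ρ ∈ S := by
    intro ρ hρ
    rcases hlone ρ ρ.2 hρ with h | h | h | h
    · rw [show ρ = ⟨e, he⟩ from Subtype.ext h, hS]; simp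
    · rw [show ρ = ⟨conj e, hce⟩ from Subtype.ext h, hS]; simp
    · rw [show ρ = ⟨1 - e, h1e⟩ from Subtype.ext h, hS]; simp
    · rw [show ρ = ⟨1 - conj e, h1ce⟩ from Subtype.ext h, hS]; simp
  set g : riemannZetaNontrivialZeros → ℝ := fun ρ ↦ if ρ ∈ S then W ρ else 0 with hg
  have hg0 : ∀ ρ ∉ S, g ρ = 0 := fun ρ hρ ↦ if_neg hρ
  have hle : ∀ ρ : riemannZetaNontrivialZeros, g ρ ≤ W ρ := by
    intro ρ
    by_cases hρ : ρ ∈ S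
    · simp only [hg, if_pos hρ, le_refl]
    · have hline : (ρ : ℂ).re = 1 / 2 := by
        by_contra hne
        exact hρ (hmemS ρ hne)
      simp only [hg, if_neg hρ, hW]
      exact re_order_mul_pairCoeff_nonneg_of_re_eq_half f ρ.2 hline
  have htsum : ∑ ρ ∈ S, W ρ ≤ ∑' ρ : riemannZetaNontrivialZeros, W ρ :=
    calc ∑ ρ ∈ S, W ρ = ∑ ρ ∈ S, g ρ := Finset.sum_congr rfl fun ρ hρ ↦ (if_pos hρ).symm
      _ = ∑' ρ, g ρ := (tsum_eq_sum hg0).symm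
      _ ≤ ∑' ρ : riemannZetaNontrivialZeros, W ρ :=
          (summable_of_ne_finset_zero hg0).tsum_le_tsum hle hsW
  have hne12 : e ≠ conj e := fun h ↦ him (by
    have := congrArg Complex.im h; simp at this; linarith)
  have hne13 : e ≠ 1 - e := fun h ↦ by
    have := congrArg Complex.re h; simp at this; linarith
  have hne14 : e ≠ 1 - conj e := fun h ↦ by
    have := congrArg Complex.re h; simp at this; linarith
  have hne23 : conj e ≠ 1 - e := fun h ↦ by
    have := congrArg Complex.re h; simp at this; linarith
  have hne24 : conj e ≠ 1 - conj e := fun h ↦ by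
    have := congrArg Complex.re h; simp at this; linarith
  have hne34 : 1 - e ≠ 1 - conj e := fun h ↦ him (by
    have := congrArg Complex.im h; simp at this; linarith)
  have hsumS : ∑ ρ ∈ S, W ρ = 4 * W e := by
    rw [hS, Finset.sum_insert, Finset.sum_insert,
      Finset.sum_pair (fun h ↦ hne34 (congrArg Subtype.val h))]
    · show W e + (W (conj e) + (W (1 - e) + W (1 - conj e))) = 4 * W e
      rw [hWce, hW1e, hW1ce]; ring
    · simp only [Finset.mem_insert, Finset.mem_singleton, Subtype.mk.injEq, not_or]
      exact ⟨hne23, hne24⟩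
    · simp only [Finset.mem_insert, Finset.mem_singleton, Subtype.mk.injEq, not_or]
      exact ⟨hne12, hne13, hne14⟩
  linarith [htot, htsum, hsumS, hWe]

/-- **(O1) Parallelogram law.** `Re Q(h_T) = Re Q(k) - Re Q(g_T)`: the Weil functional is
translation invariant, and `g_T`, `h_T` are half the sum / difference of the two translates. -/
theorem re_weilQuadratic_antiTranslate_eq {k : ℝ → ℂ} (hk : IsWeilTest k) (T : ℝ) :
    (weilQuadratic (𝔥⟪k, T⟫)).re = (weilQuadratic k).re - (weilQuadratic (𝔰⟪k, T⟫)).re := by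
  have hQh : zeroForm (𝔥⟪k, T⟫) = weilQuadratic (𝔥⟪k, T⟫) :=
    tendsto_nhds_unique (hasWeilZeroSide_zeroForm (isWeilTest_antiTranslate hk T))
      (explicit_formula_holds
        ((isWeilTest_antiTranslate hk T).weilConv (isWeilTest_antiTranslate hk T).weilReflect))
  have hQ0 : zeroForm k = weilQuadratic k :=
    tendsto_nhds_unique (hasWeilZeroSide_zeroForm hk) (explicit_formula_holds (hk.weilConv hk.weilReflect))
  have h1 := zeroForm_antiTranslate hk T
  rw [hQh, hQ0] at h1
  have h1re := congrArg Complex.re h1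
  simp only [Complex.sub_re, Complex.div_ofNat_re, Complex.ofReal_re] at h1re
  have h2 := re_weilQuadratic_symShift_eq hk T
  linarith

/-- **(O2) Odd comparison, lone-quadruple world.** For an even real Weil test `k` and every `T`:
`Re Q(h_T) ≤ Re Q(k) - 4 m(e) Re (P_k(e) F(e,T))` ((O1) and the lone lower bound (L) for the even
real test `g_T`, whose pairing at `e` is `P_k(e) F(e,T)`). -/
theorem re_weilQuadratic_antiTranslate_le_of_lone {k : ℝ → ℂ} (hk : IsWeilTest k)
    (hev : ∀ t : ℝ, k (-t) = k t) (hre : ∀ t : ℝ, (k t).im = 0) {e : ℂ}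
    (he : e ∈ riemannZetaNontrivialZeros) (hδ : 1 / 2 < e.re)
    (hlone : ∀ ρ ∈ riemannZetaNontrivialZeros,
      ρ.re ≠ 1 / 2 → ρ = e ∨ ρ = conj e ∨ ρ = 1 - e ∨ ρ = 1 - conj e) (T : ℝ) :
    (weilQuadratic (𝔥⟪k, T⟫)).re ≤ (weilQuadratic k).re -
      4 * (riemannZetaZeroOrder e * (pairCoeff k e * 𝔉⟪e, T⟫).re) := by
  have hL := re_weilQuadratic_ge_of_lone (isWeilTest_symTranslate hk T) (symTranslate_even hev T)
    (symTranslate_im hre T) he hδ hlone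
  rw [pairCoeff_symTranslate hk T e] at hL
  rw [re_weilQuadratic_antiTranslate_eq hk T]
  linarith

/-- **(O3) Phase lemma, positive tuning.** If `z · e^{2iγT} = +|z|` (`γ = Im e`), then
`(|z|/2)(sinh(2δT) - 1) ≤ Re (z F(e,T))`, `δ = Re e - 1/2`. -/
theorem le_re_mul_coshSq {z e : ℂ} {T : ℝ}
    (htune : z * cexp (((e.im * (2 * T) : ℝ) : ℂ) * I) = (‖z‖ : ℂ)) :
    ‖z‖ / 2 * (Real.sinh (2 * (e.re - 1 / 2) * T) - 1) ≤ (z * 𝔉⟪e, T⟫).re := by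
  set u : ℝ := 2 * (e.re - 1 / 2) * T with hu
  set θ : ℝ := e.im * (2 * T) with hθ
  have hexp1 : cexp ((e - 1 / 2) * ((2 * T : ℝ) : ℂ)) = (Real.exp u : ℂ) * cexp ((θ : ℂ) * I) := by
    rw [Complex.ofReal_exp, ← Complex.exp_add]
    congr 1
    apply Complex.ext <;> (simp [hu, hθ]; try ring)
  have hexp2 : cexp ((1 / 2 - e) * ((2 * T : ℝ) : ℂ)) =
      (Real.exp (-u) : ℂ) * conj (cexp ((θ : ℂ) * I)) := by
    rw [← Complex.exp_conj, Complex.ofReal_exp, ← Complex.exp_add]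
    congr 1
    apply Complex.ext <;> (simp [hu, hθ, Complex.conj_ofReal]; try ring)
  have hB : -‖z‖ ≤ (z * conj (cexp ((θ : ℂ) * I))).re := by
    refine (neg_le_neg ?_).trans (abs_le.1 (Complex.abs_re_le_norm _)).1
    rw [norm_mul, Complex.norm_conj, Complex.norm_exp_ofReal_mul_I, mul_one]
  have hz : -‖z‖ ≤ z.re := (abs_le.1 (Complex.abs_re_le_norm z)).1
  have hmain : (z * 𝔉⟪e, T⟫).re =
      (Real.exp u * (z * cexp ((θ : ℂ) * I)).re +
        Real.exp (-u) * (z * conj (cexp ((θ : ℂ) * I))).re + 2 * z.re) / 4 := by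
    rw [hexp1, hexp2,
      show z * (((Real.exp u : ℂ) * cexp ((θ : ℂ) * I) +
          (Real.exp (-u) : ℂ) * conj (cexp ((θ : ℂ) * I)) + 2) / 4) =
        ((Real.exp u : ℂ) * (z * cexp ((θ : ℂ) * I)) +
          (Real.exp (-u) : ℂ) * (z * conj (cexp ((θ : ℂ) * I))) + ((2 : ℝ) : ℂ) * z) / 4 by
        push_cast; ring]
    simp only [Complex.div_ofNat_re, Complex.add_re, Complex.re_ofReal_mul]
  rw [hmain, htune, Complex.ofReal_re, Real.sinh_eq u]
  nlinarith [mul_le_mul_of_nonneg_left hB (Real.exp_pos (-u)).le, hz, Real.exp_pos u,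
    norm_nonneg z]

/-- Positively tuned translations exist in every window of length `π/γ`:
`∃ T ∈ [T₀, T₀ + π/γ], z · e^{2iγT} = +|z|` (`exists_tuned` applied to `-z`). -/
theorem exists_tuned_pos (z : ℂ) {γ : ℝ} (hγ : 0 < γ) (T₀ : ℝ) :
    ∃ T ∈ Icc T₀ (T₀ + π / γ), z * cexp (((γ * (2 * T) : ℝ) : ℂ) * I) = (‖z‖ : ℂ) := by
  obtain ⟨T, hT, h⟩ := exists_tuned (-z) hγ T₀
  refine ⟨T, hT, ?_⟩
  rw [norm_neg, neg_mul, neg_eq_iff_eq_neg, neg_neg] at h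
  exact h

/-- `m(e) > 0` for a non-trivial zero `e`. -/
theorem riemannZetaZeroOrder_pos_real {e : ℂ} (he : e ∈ riemannZetaNontrivialZeros) :
    (0 : ℝ) < riemannZetaZeroOrder e := by
  have h : (1 : ℝ) ≤ riemannZetaZeroOrder e := by
    exact_mod_cast riemannZetaNontrivialZeros.one_le_order he
  linarith

/-- The size condition `Q < 2 m P (sinh(2δT) - 1)` holds beyond `T = arsinh(1 + Q/(2mP))/(2δ)`. -/
theorem lt_sinh_window {Q m P δ T : ℝ} (hm : 0 < m) (hP : 0 < P) (hδ : 0 < δ)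
    (hT : Real.arsinh (1 + Q / (2 * m * P)) / (2 * δ) < T) :
    Q < 2 * m * P * (Real.sinh (2 * δ * T) - 1) := by
  have hc : 0 < 2 * m * P := by positivity
  have h1 : Real.arsinh (1 + Q / (2 * m * P)) < 2 * δ * T := by
    rw [div_lt_iff₀ (by positivity)] at hT
    linarith
  have h2 := Real.sinh_lt_sinh.2 h1
  rw [Real.sinh_arsinh] at h2
  have h4 : 2 * m * P * (1 + Q / (2 * m * P)) = 2 * m * P + Q := by field_simp
  have h5 := mul_lt_mul_of_pos_left h2 hc
  rw [h4] at h5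
  linarith

/-- One odd real test with `Re Q < 0` supported in `[-a, a]` gives `OddNegIndexAtLeast 1 a`. -/
theorem oddNegIndexAtLeast_one_of_neg {g : ℝ → ℂ} (hg : IsWeilTest g)
    (hodd : ∀ t : ℝ, g (-t) = -g t) (hre : ∀ t : ℝ, (g t).im = 0) {a : ℝ}
    (hsupp : tsupport g ⊆ Icc (-a) a) (hneg : (weilQuadratic g).re < 0) :
    OddNegIndexAtLeast 1 a := by
  refine ⟨fun _ ↦ g, fun _ ↦ hg, fun _ ↦ hodd, fun _ ↦ hre, fun _ ↦ hsupp, fun c hc ↦ ?_⟩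
  have hc0 : c 0 ≠ 0 := by
    intro h
    apply hc
    funext i
    rw [Subsingleton.elim i 0, h]
    rfl
  have hsum : (fun t : ℝ ↦ ∑ i : Fin 1, (c i : ℂ) * g t) = fun t ↦ (c 0 : ℂ) * g t := by
    funext t
    simp
  rw [hsum, weilQuadratic_const_mul, Complex.normSq_ofReal, Complex.re_ofReal_mul]
  exact mul_neg_of_pos_of_neg (mul_self_pos.2 hc0) hneg

/-- **(O4) Effective odd threshold, lone-quadruple world.** `k` an even real Weil test in `[-a, a]`,
`T ≥ 0` POSITIVELY tuned (`P_k(e) e^{2iγT} = +|P_k(e)|`) with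
`Re Q(k) < 2 m(e) |P_k(e)| (sinh(2δT) - 1)` (the same inequality as in the even case). Then the odd
test `h_T` is a negative direction in `[-(a+T), a+T]`: `OddNegIndexAtLeast 1 (a + T)`. -/
theorem oddNegIndexAtLeast_one_of_lone {k : ℝ → ℂ} (hk : IsWeilTest k)
    (hev : ∀ t : ℝ, k (-t) = k t) (hre : ∀ t : ℝ, (k t).im = 0) {a : ℝ}
    (hsupp : tsupport k ⊆ Icc (-a) a) {e : ℂ} (he : e ∈ riemannZetaNontrivialZeros)
    (hδ : 1 / 2 < e.re)
    (hlone : ∀ ρ ∈ riemannZetaNontrivialZeros,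
      ρ.re ≠ 1 / 2 → ρ = e ∨ ρ = conj e ∨ ρ = 1 - e ∨ ρ = 1 - conj e)
    {T : ℝ} (hT : 0 ≤ T)
    (htune : pairCoeff k e * cexp (((e.im * (2 * T) : ℝ) : ℂ) * I) = (‖pairCoeff k e‖ : ℂ))
    (hbig : (weilQuadratic k).re <
      2 * riemannZetaZeroOrder e * ‖pairCoeff k e‖ * (Real.sinh (2 * (e.re - 1 / 2) * T) - 1)) :
    OddNegIndexAtLeast 1 (a + T) := by
  have h2 := re_weilQuadratic_antiTranslate_le_of_lone hk hev hre he hδ hlone T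
  have h3 := le_re_mul_coshSq htune
  have hm : (0 : ℝ) ≤ riemannZetaZeroOrder e := (riemannZetaZeroOrder_pos_real he).le
  have hsupp' : tsupport (𝔥⟪k, T⟫) ⊆ Icc (-(a + T)) (a + T) := by
    have h := tsupport_antiTranslate_subset hsupp T
    rwa [abs_of_nonneg hT] at h
  refine oddNegIndexAtLeast_one_of_neg (isWeilTest_antiTranslate hk T)
    (fun t ↦ by simpa using antiTranslate_odd hev T t) (fun t ↦ ?_) hsupp' ?_
  · show ((k (t - T) - k (t + T)) / 2).im = 0
    rw [Complex.div_ofNat_im, Complex.sub_im, hre, hre, sub_zero, zero_div]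
  · nlinarith [mul_le_mul_of_nonneg_left h3 hm]

/-- **(O4') The effective bound on the first ODD threshold (lone-quadruple world)** — the same
window as the even bound `sInf_evenNegIndexAtLeast_one_le_of_lone`:
`a₁^{od} ≤ a + max(0, arsinh(1 + Re Q(k)/(2 m(e)|P_k(e)|))/(2δ)) + π/γ`. -/
theorem sInf_oddNegIndexAtLeast_one_le_of_lone {k : ℝ → ℂ} (hk : IsWeilTest k)
    (hev : ∀ t : ℝ, k (-t) = k t) (hre : ∀ t : ℝ, (k t).im = 0) {a : ℝ}
    (hsupp : tsupport k ⊆ Icc (-a) a) {e : ℂ} (he : e ∈ riemannZetaNontrivialZeros)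
    (hδ : 1 / 2 < e.re) (hγ : 0 < e.im)
    (hlone : ∀ ρ ∈ riemannZetaNontrivialZeros,
      ρ.re ≠ 1 / 2 → ρ = e ∨ ρ = conj e ∨ ρ = 1 - e ∨ ρ = 1 - conj e)
    (hP : pairCoeff k e ≠ 0) :
    sInf {a' : ℝ | OddNegIndexAtLeast 1 a'} ≤
      a + max 0 (Real.arsinh (1 + (weilQuadratic k).re /
        (2 * riemannZetaZeroOrder e * ‖pairCoeff k e‖)) / (2 * (e.re - 1 / 2))) + π / e.im := by
  set R : ℝ := Real.arsinh (1 + (weilQuadratic k).re /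
    (2 * riemannZetaZeroOrder e * ‖pairCoeff k e‖)) / (2 * (e.re - 1 / 2)) with hR
  refine le_of_forall_pos_le_add fun ε hε ↦ ?_
  obtain ⟨T, ⟨hT1, hT2⟩, htune⟩ := exists_tuned_pos (pairCoeff k e) hγ (max 0 R + ε)
  have hT0 : 0 ≤ T := by linarith [le_max_left 0 R]
  have hbig := lt_sinh_window (riemannZetaZeroOrder_pos_real he) (norm_pos_iff.2 hP)
    (by linarith : 0 < e.re - 1 / 2) (by linarith [le_max_right 0 R] : R < T)
  have hidx := oddNegIndexAtLeast_one_of_lone hk hev hre hsupp he hδ hlone hT0 htune hbig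
  calc sInf {a' : ℝ | OddNegIndexAtLeast 1 a'} ≤ a + T :=
        csInf_le (bddBelow_setOf_oddNegIndexAtLeast_succ 0) hidx
    _ ≤ a + max 0 R + π / e.im + ε := by linarith

/-- **(O5)** If, in the lone-quadruple world, the window `[-A, A]` carries NO odd negative
direction, then every even real Weil test `k` in `[-a, a]` with `a + π/γ ≤ A` satisfies
`2 m(e) |P_k(e)| (sinh(2δ(A - a - π/γ)) - 1) ≤ Re Q(k)`. -/
theorem lone_zero_invisible_of_not_oddNegIndexAtLeast {k : ℝ → ℂ} (hk : IsWeilTest k)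
    (hev : ∀ t : ℝ, k (-t) = k t) (hre : ∀ t : ℝ, (k t).im = 0) {a : ℝ}
    (hsupp : tsupport k ⊆ Icc (-a) a) {e : ℂ} (he : e ∈ riemannZetaNontrivialZeros)
    (hδ : 1 / 2 < e.re) (hγ : 0 < e.im)
    (hlone : ∀ ρ ∈ riemannZetaNontrivialZeros,
      ρ.re ≠ 1 / 2 → ρ = e ∨ ρ = conj e ∨ ρ = 1 - e ∨ ρ = 1 - conj e)
    {A : ℝ} (hA : ¬ OddNegIndexAtLeast 1 A) (haA : a + π / e.im ≤ A) :
    2 * riemannZetaZeroOrder e * ‖pairCoeff k e‖ *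
        (Real.sinh (2 * (e.re - 1 / 2) * (A - a - π / e.im)) - 1) ≤ (weilQuadratic k).re := by
  by_contra hlt
  rw [not_le] at hlt
  have hπγ : 0 < π / e.im := div_pos Real.pi_pos hγ
  have hm : (0 : ℝ) ≤ riemannZetaZeroOrder e := (riemannZetaZeroOrder_pos_real he).le
  obtain ⟨T, ⟨hT1, hT2⟩, htune⟩ := exists_tuned_pos (pairCoeff k e) hγ (A - a - π / e.im)
  have hT0 : 0 ≤ T := by linarith
  have hmono : Real.sinh (2 * (e.re - 1 / 2) * (A - a - π / e.im)) ≤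
      Real.sinh (2 * (e.re - 1 / 2) * T) :=
    Real.sinh_le_sinh.2 (mul_le_mul_of_nonneg_left hT1 (by linarith))
  have hbig : (weilQuadratic k).re <
      2 * riemannZetaZeroOrder e * ‖pairCoeff k e‖ * (Real.sinh (2 * (e.re - 1 / 2) * T) - 1) :=
    hlt.trans_le (mul_le_mul_of_nonneg_left (by linarith) (by positivity))
  have hidx := oddNegIndexAtLeast_one_of_lone hk hev hre hsupp he hδ hlone hT0 htune hbig
  exact hA (PfPersistenceParityIndex.OddNegIndexAtLeast.mono hidx (by linarith))

/-- **(O6) Saturation window (lone-quadruple world).** Below the same explicit window the REAL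
negative index reaches `2` — its maximal value `2K` when `K = 1`
(`not_realNegIndexAtLeast_succ_of_two_mul_encard_le`): an even AND an odd negative direction.
`a₂^{re} ≤ a + max(0, arsinh(1 + Re Q(k)/(2 m(e)|P_k(e)|))/(2δ)) + π/γ`. -/
theorem sInf_realNegIndexAtLeast_two_le_of_lone {k : ℝ → ℂ} (hk : IsWeilTest k)
    (hev : ∀ t : ℝ, k (-t) = k t) (hre : ∀ t : ℝ, (k t).im = 0) {a : ℝ}
    (hsupp : tsupport k ⊆ Icc (-a) a) {e : ℂ} (he : e ∈ riemannZetaNontrivialZeros)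
    (hδ : 1 / 2 < e.re) (hγ : 0 < e.im)
    (hlone : ∀ ρ ∈ riemannZetaNontrivialZeros,
      ρ.re ≠ 1 / 2 → ρ = e ∨ ρ = conj e ∨ ρ = 1 - e ∨ ρ = 1 - conj e)
    (hP : pairCoeff k e ≠ 0) :
    sInf {a' : ℝ | RealNegIndexAtLeast 2 a'} ≤
      a + max 0 (Real.arsinh (1 + (weilQuadratic k).re /
        (2 * riemannZetaZeroOrder e * ‖pairCoeff k e‖)) / (2 * (e.re - 1 / 2))) + π / e.im := by
  set R : ℝ := Real.arsinh (1 + (weilQuadratic k).re /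
    (2 * riemannZetaZeroOrder e * ‖pairCoeff k e‖)) / (2 * (e.re - 1 / 2)) with hR
  refine le_of_forall_pos_le_add fun ε hε ↦ ?_
  have hbig : ∀ {T : ℝ}, R < T → (weilQuadratic k).re <
      2 * riemannZetaZeroOrder e * ‖pairCoeff k e‖ * (Real.sinh (2 * (e.re - 1 / 2) * T) - 1) :=
    fun hT ↦ lt_sinh_window (riemannZetaZeroOrder_pos_real he) (norm_pos_iff.2 hP)
      (by linarith : 0 < e.re - 1 / 2) hT
  obtain ⟨T₁, ⟨hT₁1, hT₁2⟩, htune₁⟩ := exists_tuned (pairCoeff k e) hγ (max 0 R + ε)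
  obtain ⟨T₂, ⟨hT₂1, hT₂2⟩, htune₂⟩ := exists_tuned_pos (pairCoeff k e) hγ (max 0 R + ε)
  have hR := max_le_iff.1 (le_refl (max 0 R))
  have hev₁ := evenNegIndexAtLeast_one_of_lone hk hev hre hsupp he hδ hlone (T := T₁)
    (by linarith [hR.1]) htune₁ (hbig (by linarith [hR.2]))
  have hod₂ := oddNegIndexAtLeast_one_of_lone hk hev hre hsupp he hδ hlone (T := T₂)
    (by linarith [hR.1]) htune₂ (hbig (by linarith [hR.2]))
  have hreal : RealNegIndexAtLeast 2 (a + (max 0 R + ε) + π / e.im) :=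
    realNegIndexAtLeast_add_of_even_odd (m := 1) (n := 1)
      (hev₁.mono (by linarith)) (PfPersistenceParityIndex.OddNegIndexAtLeast.mono hod₂ (by linarith))
  calc sInf {a' : ℝ | RealNegIndexAtLeast 2 a'} ≤ a + (max 0 R + ε) + π / e.im :=
        csInf_le (bddBelow_setOf_realNegIndexAtLeast_succ 1) hreal
    _ = a + max 0 R + π / e.im + ε := by ring

end Summit.RiemannHypothesis.RiemannHypothesis.Theorems.PfPersistenceM2NegIndex
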